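import Summits.NavierStokesRegularity.NavierStokesRegularity.Theses.HardyPointSink
import Literature.Analysis.FluidPDE.RieszPressureL3
import Literature.Analysis.FluidPDE.NSLerayHopfSereginProofs
import Literature.Analysis.FluidPDE.MildL3SmoothHolds
import Summits.NavierStokesRegularity.NavierStokesRegularity.Theorems.HardyPointSinkHardyEnergyBoundLocalHardyIdentity
import Summits.NavierStokesRegularity.NavierStokesRegularity.Theorems.HardyPointSinkHardyEnergyBoundSolenoidalHardyFlux
import Summits.NavierStokesRegularity.NavierStokesRegularity.Theorems.HardyPointSinkHardyEnergyBoundSpaceTimeL3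
import Summits.NavierStokesRegularity.NavierStokesRegularity.Theorems.HardyPointSinkHardyEnergyBoundLedger
import Summits.NavierStokesRegularity.NavierStokesRegularity.Theorems.HardyPointSinkHardyEnergyBoundHeartReduction
import HarnessLib.Audit

/-!
# Skeleton of the crux `HardyPointSink.HardyEnergyBound` — line `birth`, lead revision 3 (owned by lead c7, prover-line-stmt-NavierStokesRegularity-7979-c7-0, 2026-08-17; the heart RESHAPED to the backward singular centres)

(crux item `stmt-NavierStokesRegularity-7979`, route `route-NavierStokesRegularity-HardyPointSink`;
lead `prover-line-stmt-NavierStokesRegularity-7979-c1-0`, 2026-08-17; reshaped from the planner's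
`Cruxes/HardyEnergyBound/Lines/birth.lean` (sha a23f1f58…), same composition idea.)

THE CRUX. For `ν > 0`, a Clay datum `u₀`, `T > 0` and a Kato solution `u` on `[0,T)` from `u₀`:
near every `xs ∈ ℝ³` the LOCAL HARDY ENERGY `∫_{B(xs,r₀)} |u(t,x)|² / |x − x₀| dx` is bounded,
uniformly in `x₀ ∈ B(xs,r₀)` and `T − r₀² < t < T`.

THE CUT (unchanged idea: point-sink LEDGER of the Hardy energy + ABSORPTION of the head influx ⇒ crux),
with two lead changes:

* `stub_mildL3Smooth` is DISCHARGED by the tree (`Literature.Analysis.FluidPDE.mild_L3_smooth_holds`).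
* the Hardy dissipation `D` of the ledger / absorption pair is LOCALISED to `B(xs, R/2)` (the planner's
  full-space gradient needs the Leray–Hopf energy class of a Kato solution up to `T_max`, which the tree has
  only below Kato's smoothing horizon; the localised `D` is what the cut-off identity produces, and moving
  the (finite) far dissipation out of `D` does not change the content of the heart).
* the ledger `stub_hardyLedger` (known-type bookkeeping) is CUT into four registered stubs:
  `stub_localHardyIdentity` (the localised point-sink identity for classical solutions on an open time
  set, tested against `φ/|x−x₀|`), `stub_solenoidalHardyFlux` (`∫ Dφ(v)/r = ∫ φ⟨v,x−x₀⟩/r³` for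
  divergence-free `v`: the pressure constant drops out of the `φ/r`-weighted identity),
  `stub_spaceTimeL3` (the classical representative of a Kato solution lies in `L³((a,T)×ℝ³)` up to the
  final time), and the glue `stub_hardyLedger_of` (these three ⇒ the localised ledger; uses the tree's
  pressure normalisation `PressureNormalisationL3.pressure_ae_eq_rieszPressure_add_const` and the Riesz
  bound `eLpNorm_rieszPressure_le`).
* lead revision 3 (c7): the heart `stub_influxAbsorption` (≡ crux, `hardyEnergyBound_iff_influxAbsorption`,
  p153587) is RESHAPED to `stub_influxAbsorptionAtSingular` — the same absorption inequality, asked only at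
  centres `xs` with `(T, xs)` a BACKWARD SINGULAR point of the Kato solution `u`; at the other centres the
  cumulative head influx is bounded above up to `T` (`headInflux_le_of_not_isBackwardSingularPoint`,
  p172970), so the full heart follows (`influxAbsorption_of_at_backwardSingularPoints`, p173097). At a
  backward singular centre both currencies of the inequality DIVERGE as `t ↑ T`
  (`isBackwardSingularPoint_iff_headInflux_unbounded`, `isBackwardSingularPoint_iff_hardyDissipation_eq_top`,
  p172473/p172970) and `T = T_max(u₀)` (`katoMaximalTime_eq_of_isBackwardSingularPoint`); the reshaped stub is
  still crux-equivalent (`hardyEnergyBound_iff_influxAbsorption_at_backwardSingularPoints`, p173097).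

`HardyEnergyBound_of : Theses.HardyPointSink.HardyEnergyBound` is the ONLY theorem concluding the crux
(by name, no `Prop` hypotheses); it is `HardyEnergyBound_of_hyps stub_mildL3Smooth (stub_hardyLedger_of
stub_localHardyIdentity stub_solenoidalHardyFlux stub_spaceTimeL3) (influxAbsorption_of_at_backwardSingularPoints
stub_influxAbsorptionAtSingular)`, and `HardyEnergyBound_of_hyps` is the planner's CLOSED composition
(r₀ = R/4, K = C + M).
-/

noncomputable section

open Set MeasureTheory Filter Topology
open scoped ENNReal NNReal

namespace Summit.NavierStokesRegularity.NavierStokesRegularity.Cruxes.HardyEnergyBound.Birth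

set_option linter.unusedVariables false
set_option linter.dupNamespace false

/-- **stub 1 — `stub_mildL3Smooth` (DISCHARGED by the tree).** Interior regularity of mild
`C([0,T);L³)` solutions: a classical representative `(v,p)` on `(0,T)` with `v t = u t` a.e. for every
`t ∈ (0,T)` [Giga1986 Thm 4; LemarieRieusset2016 Thm 15.1(A); tree: `MildL3SmoothHolds.lean`]. -/
theorem stub_mildL3Smooth : Literature.Analysis.FluidPDE.mild_L3_smooth :=
  Literature.Analysis.FluidPDE.mild_L3_smooth_holds

/-- **stub 2a — `stub_localHardyIdentity` (L, OPEN): the localised point-sink identity.** For a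
classical solution `(v,p)` of the unforced Navier–Stokes system on an OPEN time set `S`, a smooth
compactly supported weight `φ`, a centre `x₀` and `[t₁,t₂] ⊆ S`:
`∫φ|v(t₂)|²/r − ∫φ|v(t₁)|²/r + 2ν∫∫φ|∇v|²/r + 4πν φ(x₀)∫|v(s,x₀)|² ds
  = ∫∫ ( ν|v|²(Δφ/r − 2Dφ(x−x₀)/r³) + (|v|²+2p)Dφ(v)/r − 2φ(|v|²/2+p)⟨v,x−x₀⟩/r³ )`, `r = |x−x₀|`
— the local energy identity (`IsClassicalNSSolutionOn.local_energy_identity_cutoff`) tested against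
`ψ_ε = φ·(r²+ε²)^{-1/2}` and `ε → 0` (`Δ(1/r) = −4πδ`: HardyBalanceLaw files `…Weights/KernelMass/Limits`)
[CKN1982 §2; Seregin2014 p.113; route support `HardyBalanceLaw` stmt-8388]. -/
theorem stub_localHardyIdentity :
    ∀ (S : Set ℝ) (ν : ℝ) (v : ℝ → EuclideanSpace ℝ (Fin 3) → EuclideanSpace ℝ (Fin 3))
      (p : ℝ → EuclideanSpace ℝ (Fin 3) → ℝ), IsOpen S →
      Literature.Analysis.FluidPDE.IsClassicalNSSolutionOn S ν 0 v p →
      ∀ (φ : EuclideanSpace ℝ (Fin 3) → ℝ), ContDiff ℝ (⊤ : ℕ∞) φ → HasCompactSupport φ →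
      ∀ (x₀ : EuclideanSpace ℝ (Fin 3)) (t₁ t₂ : ℝ), t₁ ≤ t₂ → Set.Icc t₁ t₂ ⊆ S →
      (∫ x, φ x * ‖v t₂ x‖ ^ 2 / ‖x - x₀‖) - (∫ x, φ x * ‖v t₁ x‖ ^ 2 / ‖x - x₀‖)
          + 2 * ν * (∫ s in t₁..t₂, ∫ x,
              φ x * Literature.Analysis.FluidPDE.frobeniusNormSq (fderiv ℝ (v s) x) / ‖x - x₀‖)
          + 4 * Real.pi * ν * φ x₀ * (∫ s in t₁..t₂, ‖v s x₀‖ ^ 2)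
        = ∫ s in t₁..t₂, ∫ x,
            (ν * ‖v s x‖ ^ 2 * (Laplacian.laplacian φ x / ‖x - x₀‖
                - 2 * fderiv ℝ φ x (x - x₀) / ‖x - x₀‖ ^ 3)
              + (‖v s x‖ ^ 2 + 2 * p s x) * fderiv ℝ φ x (v s x) / ‖x - x₀‖
              - 2 * φ x * (‖v s x‖ ^ 2 / 2 + p s x) * inner ℝ (v s x) (x - x₀) / ‖x - x₀‖ ^ 3) :=
  -- LANDED (wave 1): proved in the tree, used by name.
  _root_.Summit.NavierStokesRegularity.NavierStokesRegularity.Theorems.stub_localHardyIdentity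

/-- **stub 2b — `stub_solenoidalHardyFlux` (S, OPEN): the pressure constant drops out.** For a smooth
divergence-free field `v`, a smooth compactly supported `φ` and any `x₀`:
`∫ Dφ(x)(v x)/|x−x₀| dx = ∫ φ(x) ⟨v x, x−x₀⟩/|x−x₀|³ dx`, i.e. `∫ ⟨v, ∇(φ/r)⟩ = 0` (integration by parts
against the regularised weight `φ·(r²+ε²)^{-1/2}`, then `ε → 0` by dominated convergence; `r⁻¹, r⁻² ∈ L¹_loc(ℝ³)`)
[folklore; MajdaBertozzi2002 Prop 1.13]. -/
theorem stub_solenoidalHardyFlux :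
    ∀ (v : EuclideanSpace ℝ (Fin 3) → EuclideanSpace ℝ (Fin 3)), ContDiff ℝ (⊤ : ℕ∞) v →
      Literature.Analysis.FluidPDE.VectorCalculus.IsDivFree v →
      ∀ (φ : EuclideanSpace ℝ (Fin 3) → ℝ), ContDiff ℝ (⊤ : ℕ∞) φ → HasCompactSupport φ →
      ∀ x₀ : EuclideanSpace ℝ (Fin 3),
      ∫ x, fderiv ℝ φ x (v x) / ‖x - x₀‖ = ∫ x, φ x * inner ℝ (v x) (x - x₀) / ‖x - x₀‖ ^ 3 :=
  -- LANDED (wave 1): proved in the tree, used by name.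
  _root_.Summit.NavierStokesRegularity.NavierStokesRegularity.Theorems.stub_solenoidalHardyFlux

/-- **stub 2c — `stub_spaceTimeL3` (M, OPEN): the representative is in `L³` up to the final time.**
For `ν > 0`, a Kato solution `u` on `[0,T)` and a classical representative `(v,p)` on `(0,T)`
(`v t = u t` a.e. for every `t ∈ (0,T)`): `∫_a^T ∫ |v|³ < ∞` for every `0 < a < T` — restart at a
bounded slice `s < a` (`IsKatoSolutionOn.exists_ae_norm_le_of_pos`, `IsKatoSolutionOn.restart`) and
apply `IsKatoSolutionOn.lintegral_enorm_cube_lt_top_of_ae_bounded` (energy class of the caloric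
remainder up to the final time), then transfer `u ↦ v` (both jointly measurable, slices agree a.e.)
[LemarieRieusset2016 Thm 15.1; RusinSverak2011 §4]. -/
theorem stub_spaceTimeL3 :
    ∀ ν : ℝ, 0 < ν → ∀ (T : ℝ) (u₀ : EuclideanSpace ℝ (Fin 3) → EuclideanSpace ℝ (Fin 3))
      (u : ℝ → EuclideanSpace ℝ (Fin 3) → EuclideanSpace ℝ (Fin 3)), 0 < T →
      Literature.Analysis.FluidPDE.IsKatoSolutionOn T ν u₀ u →
      ∀ (v : ℝ → EuclideanSpace ℝ (Fin 3) → EuclideanSpace ℝ (Fin 3))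
        (p : ℝ → EuclideanSpace ℝ (Fin 3) → ℝ),
      Literature.Analysis.FluidPDE.IsClassicalNSSolutionOn (Set.Ioo 0 T) ν 0 v p →
      (∀ t ∈ Set.Ioo 0 T, v t =ᵐ[MeasureTheory.volume] u t) →
      ∀ a : ℝ, 0 < a → a < T →
      ∫⁻ z in Set.Ioo a T ×ˢ (Set.univ : Set (EuclideanSpace ℝ (Fin 3))), ‖v z.1 z.2‖ₑ ^ (3 : ℝ) < ⊤ :=
  -- LANDED (wave 1): proved in the tree, used by name.
  _root_.Summit.NavierStokesRegularity.NavierStokesRegularity.Theorems.stub_spaceTimeL3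

/-- **stub 2d — `stub_hardyLedger_of` (L, OPEN): the glue.** The localised identity (2a), the
solenoidal flux identity (2b) and the space-time `L³` bound (2c) imply the LOCALISED LEDGER: for the
Clay/Kato frame, every classical representative `(v,p)` of `u` on `(0,T)`, every centre `xs` and scale
`0 < R`, `R² < T`, there is `C` with, for all `x₀ ∈ B(xs,R/4)`, `T − R² ≤ t < T`,
`H + D ≤ C + ofReal(−2·I)`, `H = ∫⁻_{B(xs,R/4)} |v t|²/|x−x₀|`,
`D = ∫⁻_{(T−R²,t)} (2ν∫⁻_{B(xs,R/2)} |∇v|²_F/|x−x₀| + 4πν|v(s,x₀)|²) ds`,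
`I = ∫_{T−R²}^t ∫_{B(xs,R)} (|v|²/2 + Π_Riesz[v s])⟨v,x−x₀⟩/|x−x₀|³`. Route: (2a) between `T−R²` and `t`
with a plateau cut-off `φ` (`= 1` on `B(xs,R/2)`, supported in `B(xs,R)`, `ContDiffBump`); by (2b) the
classical pressure may be replaced by the Riesz pressure in the two pressure terms together (tree:
`PressureNormalisationL3.pressure_ae_eq_rieszPressure_add_const` on `(0,S)`, `t < S < T`); the cut-off
terms live on the annulus where `|x−x₀| ≥ R/4` and, like the deficit between the `φ`-weighted and the
sharp-ball influx and `H_φ(T−R²)`, are bounded uniformly in `(x₀,t)` by `∫_{T−R²}^T∫_{B(xs,R)}(|v|²+|v|³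
+ |Π_Riesz||v|)` (2c + `eLpNorm_rieszPressure_le` + Hölder) — that bound is `C` [CKN1982 §2, §8]. -/
theorem stub_hardyLedger_of :
    (∀ (S : Set ℝ) (ν : ℝ) (v : ℝ → EuclideanSpace ℝ (Fin 3) → EuclideanSpace ℝ (Fin 3))
      (p : ℝ → EuclideanSpace ℝ (Fin 3) → ℝ), IsOpen S →
      Literature.Analysis.FluidPDE.IsClassicalNSSolutionOn S ν 0 v p →
      ∀ (φ : EuclideanSpace ℝ (Fin 3) → ℝ), ContDiff ℝ (⊤ : ℕ∞) φ → HasCompactSupport φ →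
      ∀ (x₀ : EuclideanSpace ℝ (Fin 3)) (t₁ t₂ : ℝ), t₁ ≤ t₂ → Set.Icc t₁ t₂ ⊆ S →
      (∫ x, φ x * ‖v t₂ x‖ ^ 2 / ‖x - x₀‖) - (∫ x, φ x * ‖v t₁ x‖ ^ 2 / ‖x - x₀‖)
          + 2 * ν * (∫ s in t₁..t₂, ∫ x,
              φ x * Literature.Analysis.FluidPDE.frobeniusNormSq (fderiv ℝ (v s) x) / ‖x - x₀‖)
          + 4 * Real.pi * ν * φ x₀ * (∫ s in t₁..t₂, ‖v s x₀‖ ^ 2)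
        = ∫ s in t₁..t₂, ∫ x,
            (ν * ‖v s x‖ ^ 2 * (Laplacian.laplacian φ x / ‖x - x₀‖
                - 2 * fderiv ℝ φ x (x - x₀) / ‖x - x₀‖ ^ 3)
              + (‖v s x‖ ^ 2 + 2 * p s x) * fderiv ℝ φ x (v s x) / ‖x - x₀‖
              - 2 * φ x * (‖v s x‖ ^ 2 / 2 + p s x) * inner ℝ (v s x) (x - x₀) / ‖x - x₀‖ ^ 3)) →
    (∀ (v : EuclideanSpace ℝ (Fin 3) → EuclideanSpace ℝ (Fin 3)), ContDiff ℝ (⊤ : ℕ∞) v →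
      Literature.Analysis.FluidPDE.VectorCalculus.IsDivFree v →
      ∀ (φ : EuclideanSpace ℝ (Fin 3) → ℝ), ContDiff ℝ (⊤ : ℕ∞) φ → HasCompactSupport φ →
      ∀ x₀ : EuclideanSpace ℝ (Fin 3),
      ∫ x, fderiv ℝ φ x (v x) / ‖x - x₀‖ = ∫ x, φ x * inner ℝ (v x) (x - x₀) / ‖x - x₀‖ ^ 3) →
    (∀ ν : ℝ, 0 < ν → ∀ (T : ℝ) (u₀ : EuclideanSpace ℝ (Fin 3) → EuclideanSpace ℝ (Fin 3))
      (u : ℝ → EuclideanSpace ℝ (Fin 3) → EuclideanSpace ℝ (Fin 3)), 0 < T →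
      Literature.Analysis.FluidPDE.IsKatoSolutionOn T ν u₀ u →
      ∀ (v : ℝ → EuclideanSpace ℝ (Fin 3) → EuclideanSpace ℝ (Fin 3))
        (p : ℝ → EuclideanSpace ℝ (Fin 3) → ℝ),
      Literature.Analysis.FluidPDE.IsClassicalNSSolutionOn (Set.Ioo 0 T) ν 0 v p →
      (∀ t ∈ Set.Ioo 0 T, v t =ᵐ[MeasureTheory.volume] u t) →
      ∀ a : ℝ, 0 < a → a < T →
      ∫⁻ z in Set.Ioo a T ×ˢ (Set.univ : Set (EuclideanSpace ℝ (Fin 3))), ‖v z.1 z.2‖ₑ ^ (3 : ℝ) < ⊤) →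
    ∀ ν : ℝ, 0 < ν → ∀ u₀ : EuclideanSpace ℝ (Fin 3) → EuclideanSpace ℝ (Fin 3),
      ContDiff ℝ (⊤ : ℕ∞) u₀ → Literature.Analysis.FluidPDE.NSWave0.IsDivFree u₀ →
      Literature.Analysis.FluidPDE.HasRapidSpatialDecay u₀ →
      ∀ (T : ℝ) (u : ℝ → EuclideanSpace ℝ (Fin 3) → EuclideanSpace ℝ (Fin 3)), 0 < T →
      Literature.Analysis.FluidPDE.IsKatoSolutionOn T ν u₀ u →
      ∀ (v : ℝ → EuclideanSpace ℝ (Fin 3) → EuclideanSpace ℝ (Fin 3))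
        (p : ℝ → EuclideanSpace ℝ (Fin 3) → ℝ),
      Literature.Analysis.FluidPDE.IsClassicalNSSolutionOn (Set.Ioo 0 T) ν 0 v p →
      (∀ t ∈ Set.Ioo 0 T, v t =ᵐ[MeasureTheory.volume] u t) →
      ∀ (xs : EuclideanSpace ℝ (Fin 3)) (R : ℝ), 0 < R → R ^ 2 < T →
      ∃ C : NNReal, ∀ x₀ ∈ Metric.ball xs (R / 4), ∀ t ∈ Set.Ico (T - R ^ 2) T,
        (∫⁻ x in Metric.ball xs (R / 4), ‖v t x‖ₑ ^ 2 / ‖x - x₀‖ₑ)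
          + (∫⁻ s in Set.Ioo (T - R ^ 2) t,
              (ENNReal.ofReal (2 * ν)
                  * (∫⁻ x in Metric.ball xs (R / 2),
                      ENNReal.ofReal (Literature.Analysis.FluidPDE.frobeniusNormSq (fderiv ℝ (v s) x))
                        / ‖x - x₀‖ₑ)
                + ENNReal.ofReal (4 * Real.pi * ν) * ‖v s x₀‖ₑ ^ 2))
        ≤ (C : ENNReal)
          + ENNReal.ofReal (-2 * ∫ s in (T - R ^ 2)..t, ∫ x in Metric.ball xs R,
              (‖v s x‖ ^ 2 / 2 + Literature.Analysis.FluidPDE.rieszPressure (v s) x)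
                * inner ℝ (v s x) (x - x₀) / ‖x - x₀‖ ^ 3) :=
  -- LANDED (wave 1): proved in the tree, used by name.
  _root_.Summit.NavierStokesRegularity.NavierStokesRegularity.Theorems.stub_hardyLedger_of

/-- **stub 3 — `stub_influxAbsorptionAtSingular` (XL, OPEN, the heart at the backward singular centres):
at a singular point the divergent head influx exceeds the divergent Hardy dissipation plus point sink by at
most a constant.** For `ν > 0`, a Clay datum, `T > 0`, a Kato solution `u` on `[0,T)`, its classical
representative `(v,p)` on `(0,T)` and a centre `xs` with `(T, xs)` a BACKWARD SINGULAR point of `u`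
(`IsBackwardSingularPoint u (T, xs)`; then `T = T_max(u₀)` and both `−2I(xs;·,t)` and `D(xs;·,t)` tend to
`+∞` as `t ↑ T`, p172473/p172970/p166419), there are `R` (`0 < R`, `R² < T`) and `M` with
`ofReal(−2·I(x₀;T−R²,t)) ≤ D(x₀;T−R²,t) + M` for all `x₀ ∈ B(xs,R/4)`, `T − R² ≤ t < T`, `D` the LOCALISED
dissipation of stub 2d [route card hardy-point-sink-head-influx; SereginSverak2002 (one-sided head); fails
at a Type-II or tailed Type-I blow-up — Hou arXiv:2107.06509 if singular; EQUIVALENT to the crux itself: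
`hardyEnergyBound_iff_influxAbsorption_at_backwardSingularPoints`, p173097]. -/
theorem stub_influxAbsorptionAtSingular :
    ∀ ν : ℝ, 0 < ν → ∀ u₀ : EuclideanSpace ℝ (Fin 3) → EuclideanSpace ℝ (Fin 3),
      ContDiff ℝ (⊤ : ℕ∞) u₀ → Literature.Analysis.FluidPDE.NSWave0.IsDivFree u₀ →
      Literature.Analysis.FluidPDE.HasRapidSpatialDecay u₀ →
      ∀ (T : ℝ) (u : ℝ → EuclideanSpace ℝ (Fin 3) → EuclideanSpace ℝ (Fin 3)), 0 < T →
      Literature.Analysis.FluidPDE.IsKatoSolutionOn T ν u₀ u →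
      ∀ (v : ℝ → EuclideanSpace ℝ (Fin 3) → EuclideanSpace ℝ (Fin 3))
        (p : ℝ → EuclideanSpace ℝ (Fin 3) → ℝ),
      Literature.Analysis.FluidPDE.IsClassicalNSSolutionOn (Set.Ioo 0 T) ν 0 v p →
      (∀ t ∈ Set.Ioo 0 T, v t =ᵐ[MeasureTheory.volume] u t) →
      ∀ xs : EuclideanSpace ℝ (Fin 3),
        Literature.Analysis.FluidPDE.IsBackwardSingularPoint u
          ((T, xs) : ℝ × EuclideanSpace ℝ (Fin 3)) →
        ∃ R : ℝ, 0 < R ∧ R ^ 2 < T ∧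
      ∃ M : NNReal, ∀ x₀ ∈ Metric.ball xs (R / 4), ∀ t ∈ Set.Ico (T - R ^ 2) T,
        ENNReal.ofReal (-2 * ∫ s in (T - R ^ 2)..t, ∫ x in Metric.ball xs R,
              (‖v s x‖ ^ 2 / 2 + Literature.Analysis.FluidPDE.rieszPressure (v s) x)
                * inner ℝ (v s x) (x - x₀) / ‖x - x₀‖ ^ 3)
        ≤ (∫⁻ s in Set.Ioo (T - R ^ 2) t,
              (ENNReal.ofReal (2 * ν)
                  * (∫⁻ x in Metric.ball xs (R / 2),
                      ENNReal.ofReal (Literature.Analysis.FluidPDE.frobeniusNormSq (fderiv ℝ (v s) x))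
                        / ‖x - x₀‖ₑ)
                + ENNReal.ofReal (4 * Real.pi * ν) * ‖v s x₀‖ₑ ^ 2))
          + (M : ENNReal) := by
  sorry

/-- ENNReal bookkeeping of the composition: a ledger `H + D ≤ C + X` with finite source `X` and an
absorption bound `X ≤ D + M` give `H ≤ C + M` (the dissipation `D` is finite by the ledger and cancels). -/
theorem hardy_le_of_ledger_of_absorption {H D X : ℝ≥0∞} {C M : ℝ≥0} (hX : X ≠ ∞)
    (h1 : H + D ≤ C + X) (h2 : X ≤ D + M) : H ≤ ((C + M : ℝ≥0) : ℝ≥0∞) := by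
  have hD : D ≠ ∞ := by
    refine ne_top_of_le_ne_top ?_ (le_trans le_add_self h1)
    exact ENNReal.add_ne_top.2 ⟨ENNReal.coe_ne_top, hX⟩
  have h3 : H + D ≤ (C + M : ℝ≥0∞) + D := by
    calc H + D ≤ C + X := h1
      _ ≤ C + (D + M) := by gcongr
      _ = (C + M : ℝ≥0∞) + D := by ring
  have h4 : H ≤ (C : ℝ≥0∞) + M := (ENNReal.add_le_add_iff_right hD).1 h3
  simpa [ENNReal.coe_add] using h4

/-- **Composition, closed form** (planner's, with the localised dissipation). The representative stub,
the (localised) ledger statement and the (localised) absorption statement imply the crux statement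
(written out verbatim; `HardyEnergyBound_of` below restates the conclusion BY NAME): interior regularity
gives the classical representative `(v, p)` of the Kato solution on `(0,T)`; absorption gives the scale
`R` and the remainder `M` at `xs`; the ledger at that scale gives `C`; for `x₀ ∈ B(xs,R/4)` and
`T - (R/4)² < t < T` the local Hardy energy of `u` equals that of `v` (slices agree a.e.), and
`H + D ≤ C + X`, `X ≤ D + M`, `X < ∞` give `H ≤ C + M`. -/
theorem HardyEnergyBound_of_hyps
    (h1 : Literature.Analysis.FluidPDE.mild_L3_smooth)
    (h2 : ∀ ν : ℝ, 0 < ν → ∀ u₀ : EuclideanSpace ℝ (Fin 3) → EuclideanSpace ℝ (Fin 3),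
      ContDiff ℝ (⊤ : ℕ∞) u₀ → Literature.Analysis.FluidPDE.NSWave0.IsDivFree u₀ →
      Literature.Analysis.FluidPDE.HasRapidSpatialDecay u₀ →
      ∀ (T : ℝ) (u : ℝ → EuclideanSpace ℝ (Fin 3) → EuclideanSpace ℝ (Fin 3)), 0 < T →
      Literature.Analysis.FluidPDE.IsKatoSolutionOn T ν u₀ u →
      ∀ (v : ℝ → EuclideanSpace ℝ (Fin 3) → EuclideanSpace ℝ (Fin 3))
        (p : ℝ → EuclideanSpace ℝ (Fin 3) → ℝ),
      Literature.Analysis.FluidPDE.IsClassicalNSSolutionOn (Set.Ioo 0 T) ν 0 v p →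
      (∀ t ∈ Set.Ioo 0 T, v t =ᵐ[MeasureTheory.volume] u t) →
      ∀ (xs : EuclideanSpace ℝ (Fin 3)) (R : ℝ), 0 < R → R ^ 2 < T →
      ∃ C : NNReal, ∀ x₀ ∈ Metric.ball xs (R / 4), ∀ t ∈ Set.Ico (T - R ^ 2) T,
        (∫⁻ x in Metric.ball xs (R / 4), ‖v t x‖ₑ ^ 2 / ‖x - x₀‖ₑ)
          + (∫⁻ s in Set.Ioo (T - R ^ 2) t,
              (ENNReal.ofReal (2 * ν)
                  * (∫⁻ x in Metric.ball xs (R / 2),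
                      ENNReal.ofReal (Literature.Analysis.FluidPDE.frobeniusNormSq (fderiv ℝ (v s) x))
                        / ‖x - x₀‖ₑ)
                + ENNReal.ofReal (4 * Real.pi * ν) * ‖v s x₀‖ₑ ^ 2))
        ≤ (C : ENNReal)
          + ENNReal.ofReal (-2 * ∫ s in (T - R ^ 2)..t, ∫ x in Metric.ball xs R,
              (‖v s x‖ ^ 2 / 2 + Literature.Analysis.FluidPDE.rieszPressure (v s) x)
                * inner ℝ (v s x) (x - x₀) / ‖x - x₀‖ ^ 3))
    (h3 : ∀ ν : ℝ, 0 < ν → ∀ u₀ : EuclideanSpace ℝ (Fin 3) → EuclideanSpace ℝ (Fin 3),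
      ContDiff ℝ (⊤ : ℕ∞) u₀ → Literature.Analysis.FluidPDE.NSWave0.IsDivFree u₀ →
      Literature.Analysis.FluidPDE.HasRapidSpatialDecay u₀ →
      ∀ (T : ℝ) (u : ℝ → EuclideanSpace ℝ (Fin 3) → EuclideanSpace ℝ (Fin 3)), 0 < T →
      Literature.Analysis.FluidPDE.IsKatoSolutionOn T ν u₀ u →
      ∀ (v : ℝ → EuclideanSpace ℝ (Fin 3) → EuclideanSpace ℝ (Fin 3))
        (p : ℝ → EuclideanSpace ℝ (Fin 3) → ℝ),
      Literature.Analysis.FluidPDE.IsClassicalNSSolutionOn (Set.Ioo 0 T) ν 0 v p →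
      (∀ t ∈ Set.Ioo 0 T, v t =ᵐ[MeasureTheory.volume] u t) →
      ∀ xs : EuclideanSpace ℝ (Fin 3), ∃ R : ℝ, 0 < R ∧ R ^ 2 < T ∧
      ∃ M : NNReal, ∀ x₀ ∈ Metric.ball xs (R / 4), ∀ t ∈ Set.Ico (T - R ^ 2) T,
        ENNReal.ofReal (-2 * ∫ s in (T - R ^ 2)..t, ∫ x in Metric.ball xs R,
              (‖v s x‖ ^ 2 / 2 + Literature.Analysis.FluidPDE.rieszPressure (v s) x)
                * inner ℝ (v s x) (x - x₀) / ‖x - x₀‖ ^ 3)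
        ≤ (∫⁻ s in Set.Ioo (T - R ^ 2) t,
              (ENNReal.ofReal (2 * ν)
                  * (∫⁻ x in Metric.ball xs (R / 2),
                      ENNReal.ofReal (Literature.Analysis.FluidPDE.frobeniusNormSq (fderiv ℝ (v s) x))
                        / ‖x - x₀‖ₑ)
                + ENNReal.ofReal (4 * Real.pi * ν) * ‖v s x₀‖ₑ ^ 2))
          + (M : ENNReal)) :
    ∀ ν : ℝ, 0 < ν → ∀ u₀ : EuclideanSpace ℝ (Fin 3) → EuclideanSpace ℝ (Fin 3),
      ContDiff ℝ (⊤ : ℕ∞) u₀ → Literature.Analysis.FluidPDE.NSWave0.IsDivFree u₀ →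
      Literature.Analysis.FluidPDE.HasRapidSpatialDecay u₀ →
      ∀ (T : ℝ) (u : ℝ → EuclideanSpace ℝ (Fin 3) → EuclideanSpace ℝ (Fin 3)), 0 < T →
      Literature.Analysis.FluidPDE.IsKatoSolutionOn T ν u₀ u → ∀ xs : EuclideanSpace ℝ (Fin 3),
      ∃ r₀ : ℝ, 0 < r₀ ∧ ∃ K : NNReal, ∀ x₀ ∈ Metric.ball xs r₀, ∀ t ∈ Set.Ico 0 T, T - r₀ ^ 2 < t →
        ∫⁻ x in Metric.ball xs r₀, ‖u t x‖ₑ ^ 2 / ‖x - x₀‖ₑ ≤ K := by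
  intro ν hν u₀ hsm hdiv hdec T u hT hu xs
  -- the classical representative of the Kato solution on the open strip `(0, T)`
  obtain ⟨v, p, hcl, hae⟩ := h1 hν hT (hu.memLp_initial hT) (hu.isWeaklyDivFree_initial hT) hu.mild
    hu.continuousInLpOn hu.aestronglyMeasurable
  -- absorption: the scale `R` and the remainder `M` at the centre `xs`
  obtain ⟨R, hR, hRT, M, hM⟩ := h3 ν hν u₀ hsm hdiv hdec T u hT hu v p hcl hae xs
  -- the ledger at that scale
  obtain ⟨C, hC⟩ := h2 ν hν u₀ hsm hdiv hdec T u hT hu v p hcl hae xs R hR hRT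
  refine ⟨R / 4, by positivity, C + M, ?_⟩
  intro x₀ hx₀ t ht hlt
  -- the time window: `T - R² ≤ T - (R/4)² < t < T`, in particular `0 < t`
  have h16 : (R / 4) ^ 2 = R ^ 2 / 16 := by ring
  have hsq : 0 ≤ R ^ 2 := sq_nonneg R
  have hR2t : T - R ^ 2 < t := by rw [h16] at hlt; linarith
  have ht' : t ∈ Set.Ico (T - R ^ 2) T := ⟨hR2t.le, ht.2⟩
  have htI : t ∈ Set.Ioo 0 T := ⟨by linarith, ht.2⟩
  -- the local Hardy energy of `u` at time `t` is that of its smooth representative `v`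
  have hHv : (∫⁻ x in Metric.ball xs (R / 4), ‖u t x‖ₑ ^ 2 / ‖x - x₀‖ₑ)
      = ∫⁻ x in Metric.ball xs (R / 4), ‖v t x‖ₑ ^ 2 / ‖x - x₀‖ₑ := by
    refine lintegral_congr_ae ?_
    filter_upwards [ae_restrict_of_ae (hae t htI)] with x hx
    rw [hx]
  rw [hHv]
  -- ledger + absorption + finiteness of the source term
  exact hardy_le_of_ledger_of_absorption ENNReal.ofReal_ne_top (hC x₀ hx₀ t ht') (hM x₀ hx₀ t ht')

/-- **The registered skeleton: the crux BY NAME from the declared stubs** (A12 layer invariant — no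
`Prop` hypotheses; the placeholders live only inside `stub_localHardyIdentity`, `stub_solenoidalHardyFlux`,
`stub_spaceTimeL3`, `stub_hardyLedger_of` (all LANDED), `stub_influxAbsorptionAtSingular` (OPEN), used by
name; `stub_mildL3Smooth` is discharged by the tree; the heart at the non-singular centres is the tree
theorem `Theorems.influxAbsorption_of_at_backwardSingularPoints` (p173097); the composition
`HardyEnergyBound_of_hyps` is closed). -/
theorem HardyEnergyBound_of : Theses.HardyPointSink.HardyEnergyBound :=
  HardyEnergyBound_of_hyps stub_mildL3Smooth
    (stub_hardyLedger_of stub_localHardyIdentity stub_solenoidalHardyFlux stub_spaceTimeL3)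
    (_root_.Summit.NavierStokesRegularity.NavierStokesRegularity.Theorems.influxAbsorption_of_at_backwardSingularPoints
      stub_influxAbsorptionAtSingular)

end Summit.NavierStokesRegularity.NavierStokesRegularity.Cruxes.HardyEnergyBound.Birth
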